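import Summits.QuantumFields.YangMills.Theorems.BalabanUVNodesPortS1RecordDtJacReal

/-!
# Port S1, socket (o3)-VIII — THE TRANSLATION's JACOBIAN IS THE IDENTITY OFF THE `b₀`-ROWS, AND THE CHAIN RULE `DQ̃_ℂ(Φ B) ∘ DΦ(B) = LQ̃_ℂ`
# ([I] p.267 «The function hB is equal to 0 everywhere, except the set {b₀(c)}», «the transformation B′ = B − hD̃(B) linearizes the function Q̃(B′)»)

Cell `ym-nodeO-ideate`, porter seat PT-A-1 (gen 10); `--kind proof --supports stmt-QuantumFields-27930 --as helper`; count-neutral.  [I] = [Balaban1987RG1]; [15] = [Balaban1985Variational].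
Two structural facts the FE chart law's Jacobian bookkeeping ((L3-d) of `FIBRE-CHART-LAW-v1.md`) reads: since `h` is supported on the `b₀`-rows, `DΦ(B) = 1 − h_ℂ∘DD̃(B)` acts as the identity on every
non-`b₀` coordinate (so `DΦ(B)` is block-triangular and `det DΦ(B)` is the determinant of its `b₀`-block — the block form is the next brick); and differentiating the linearisation identity
`Q̃_ℂ(Φ B) = LQ̃_ℂ B` (✓`recordQtC_sub_hop_recordDt_eq`) gives `DQ̃_ℂ(Φ B) ∘L DΦ(B) = LQ̃_ℂ`, equivalently `DQ̃_ℂ(B′) = LQ̃_ℂ ∘L DΨ(B′)` at `B′ = Φ B` — print's «coefficient at the variable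
B′(b₀(c))» bookkeeping behind `det A₁ · det DΦ = det ∂_{b₀}Q̃`.

WHAT IS PROVED (letters (o1-ε) at a quantified radius `ρ`; `R = 1∕(10⁸dL)`, `C₂ = 2∕R²`):
* §1 (hypothesis-free support facts) `hop_comp_apply_of_not_mem` (`(h_ℂ ∘L A) v i = 0` off the `b₀`-rows), ★ `one_sub_hop_comp_apply_of_not_mem` (`((1 − h_ℂ ∘L A) v) i = v i` there), hence for
  `A := DD̃(B)`: `DΦ(B)` IS THE IDENTITY ON NON-`b₀` COORDINATES; real side ★ `fderiv_recordDtCorrOf_recordDt_apply_of_not_mem` (`(D corr(y) v) i = 0` off the `b₀`-rows, `‖ι y‖ < ρ`).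
* §2 ★★ `fderiv_recordQtC_recordPhi_comp_fderiv_recordPhi` — `DQ̃_ℂ(Φ B) ∘L (1 − h_ℂ ∘L DD̃(B)) = LQ̃_ℂ` for `‖B‖ < ρ` under `RecordB0BlockInvertible` (chain rule on the landed linearisation, uniqueness
  of the derivative on the open ball); ★★ `fderiv_recordQtC_recordPhi_eq` — `DQ̃_ℂ(Φ B) = LQ̃_ℂ ∘L DΨ(Φ B)` (right-multiply by `DΨ`, ✓`fderiv_recordPsi_mul_one_sub_hop_comp_fderiv_recordDt`).

HONEST FRAMING.  Calculus bookkeeping over landed bricks; the block-determinant form `det DΦ = det(b₀-block)` and the fibre-density identity `|det ∂_{b₀}Q̃|⁻¹ = |det A₁|⁻¹·|det DΦ|` are NOT here (next);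
nothing of Bałaban's renormalization-group estimates asserted, ported or discharged; `stub_FE(step)` (XXL) ∕ `stub_P0C` OPEN, ⟨27930⟩ OPEN (1∕3); NODE O 0∕1; COUNT 8∕28 · K 1∕4 UNMOVED; finite `𝕋⁴_{L^K}` at
fixed ε — NOT continuum ∕ OS; **the Yang–Mills mass gap (Clay) is NOT proved by any of this.**  No `sorry`, no `def`, no `instance`; standard axioms only.
-/

noncomputable section

open scoped BigOperators Matrix.Norms.L2Operator Topology

open Set Metric Filter

namespace Summit.QuantumFields.YangMills.Theorems.BalabanUVNodesPortS1

open Summit.QuantumFields.YangMills.Theorems.K0RecordFormatNames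
open Literature.MathematicalPhysics.QuantumFieldTheory.Balaban1983to89
open Literature.MathematicalPhysics.QuantumFieldTheory.Balaban1983to89.Node00
open Literature.MathematicalPhysics.QuantumFieldTheory.Balaban1983to89.T4Continuum (T4Family)
open Literature.MathematicalPhysics.QuantumFieldTheory.Balaban1983to89.BlockAveraging (Small Idx)
open Literature.MathematicalPhysics.QuantumFieldTheory.Balaban1983to89.ExpMeanLog (expMeanLogSU)
open _root_.Matrix

variable (F : T4Family)

/-! ## §1  `h` is supported on the `b₀`-rows: `1 − h_ℂ ∘L A` is the identity on every other coordinate -/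

/-- `(h_ℂ ∘L A) v` vanishes at every non-`b₀` coordinate. [cite: Balaban1987RG1, p.267 («hB is equal to 0 everywhere, except the set {b₀(c)}»)] -/
theorem hop_comp_apply_of_not_mem (k K : ℕ) (Vk : GaugeField (F.P K) k (SU 2)) (A : (FluctIdx F k K → ℂ) →L[ℂ] (PBond (F.P K) (k + 1) → MatA 2))
    (v : FluctIdx F k K → ℂ) (i : FluctIdx F k K) (hi : i.1 ∉ Set.range (recordB0 F k K)) :
    ((LinearMap.toContinuousLinearMap (hopLinGraphC F k K Vk)).comp A) v i = 0 := by
  show hopLinGraphC F k K Vk (A v) i = 0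
  exact hopLinGraphC_apply_of_not_mem F k K Vk _ i hi

/-- ★ **`1 − h_ℂ ∘L A` IS THE IDENTITY ON NON-`b₀` COORDINATES** — in particular `DΦ(B) = 1 − h_ℂ ∘L DD̃(B)` is (block-triangular with identity lower block). [cite: Balaban1987RG1, p.267] -/
theorem one_sub_hop_comp_apply_of_not_mem (k K : ℕ) (Vk : GaugeField (F.P K) k (SU 2)) (A : (FluctIdx F k K → ℂ) →L[ℂ] (PBond (F.P K) (k + 1) → MatA 2))
    (v : FluctIdx F k K → ℂ) (i : FluctIdx F k K) (hi : i.1 ∉ Set.range (recordB0 F k K)) :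
    (((1 : (FluctIdx F k K → ℂ) →L[ℂ] (FluctIdx F k K → ℂ)) - (LinearMap.toContinuousLinearMap (hopLinGraphC F k K Vk)).comp A) v) i = v i := by
  rw [_root_.sub_apply, Pi.sub_apply, hop_comp_apply_of_not_mem F k K Vk A v i hi, sub_zero]
  rfl

/-- `1 + h_ℂ ∘L A` is the identity on non-`b₀` coordinates too (`DΨ(B′) = 1 + h_ℂ ∘L DC̃_ℂ(B′)`). [cite: Balaban1987RG1, p.267] -/
theorem one_add_hop_comp_apply_of_not_mem (k K : ℕ) (Vk : GaugeField (F.P K) k (SU 2)) (A : (FluctIdx F k K → ℂ) →L[ℂ] (PBond (F.P K) (k + 1) → MatA 2))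
    (v : FluctIdx F k K → ℂ) (i : FluctIdx F k K) (hi : i.1 ∉ Set.range (recordB0 F k K)) :
    (((1 : (FluctIdx F k K → ℂ) →L[ℂ] (FluctIdx F k K → ℂ)) + (LinearMap.toContinuousLinearMap (hopLinGraphC F k K Vk)).comp A) v) i = v i := by
  rw [_root_.add_apply, Pi.add_apply, hop_comp_apply_of_not_mem F k K Vk A v i hi, add_zero]
  rfl

section Letters

variable {F}
variable {k K : ℕ} (hk : k + 1 ≤ (F.P K).m + (F.P K).K) (Vk : GaugeField (F.P K) k (SU 2)) {ε : ℝ}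
  (hε : ∀ (c : PBond (F.P K) (k + 1)) (i : Idx (F.P K)), ‖loopM (coeField Vk) c i - 1‖ ≤ ε) (hε50 : ε ≤ 1 / 50)
  (hVk : ∀ c, Small expMeanLogSU Vk c) {b ρ : ℝ} (hb : 0 ≤ b) (hHop : ∀ X, ‖hopLinGraphC F k K Vk X‖ ≤ b * ‖X‖)
  (hq : 9 * (2 * 1 / (1 / (10 ^ 8 * (F.P K).d * (F.P K).L)) ^ 2) * b * ρ < 1) (hρ : 3 * ρ ≤ 1 / (10 ^ 8 * (F.P K).d * (F.P K).L))

include hk hε hε50 hVk hb hHop hq hρ in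
/-- ★ **THE REAL CORRECTION's DERIVATIVE VANISHES OFF THE `b₀`-ROWS**: `(fderiv ℝ recordDtCorrOf y v) i = 0` for `i` not a `b₀`-coordinate, `‖ι y‖ < ρ` — the real translation `y ↦ y − corr(y)`
moves the central coordinates only. [cite: Balaban1987RG1, p.267] -/
theorem fderiv_recordDtCorrOf_recordDt_apply_of_not_mem (y : FluctIdx F k K → ℝ) (hy : ‖(fun i => (y i : ℂ))‖ < ρ) (v : FluctIdx F k K → ℝ)
    (i : FluctIdx F k K) (hi : i.1 ∉ Set.range (recordB0 F k K)) :
    fderiv ℝ (recordDtCorrOf F k (fun Vk => recordDt F k K Vk ρ) Vk) y v i = 0 := by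
  have h := ofReal_fderiv_recordDtCorrOf_recordDt_apply hk Vk hε hε50 hVk hb hHop hq hρ y hy v i
  rw [hopLinGraphC_apply_of_not_mem F k K Vk _ i hi] at h
  exact_mod_cast h

/-! ## §2  The chain rule on the linearisation: `DQ̃_ℂ(Φ B) ∘ DΦ(B) = LQ̃_ℂ` -/

include hk hε hε50 hVk hb hHop hq hρ in
/-- ★★ **`DQ̃_ℂ(Φ B) ∘L (1 − h_ℂ ∘L DD̃(B)) = LQ̃_ℂ`** for `‖B‖ < ρ` under `RecordB0BlockInvertible` — differentiate `Q̃_ℂ ∘ Φ = LQ̃_ℂ` on the open ball (✓`recordQtC_sub_hop_recordDt_eq`, ✓`hasFDerivAt_recordDt`).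
[cite: Balaban1987RG1, p.267 («linearizes the function Q̃(B′)»)] -/
theorem fderiv_recordQtC_recordPhi_comp_fderiv_recordPhi (hA : RecordB0BlockInvertible F k K Vk) {B : FluctIdx F k K → ℂ} (hB : ‖B‖ < ρ) :
    (fderiv ℂ (recordQtC F k K Vk) (B - hopLinGraphC F k K Vk (recordDt F k K Vk ρ B))).comp
        ((1 : (FluctIdx F k K → ℂ) →L[ℂ] (FluctIdx F k K → ℂ)) -
          (LinearMap.toContinuousLinearMap (hopLinGraphC F k K Vk)).comp (fderiv ℂ (recordDt F k K Vk ρ) B)) =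
      recordLQtC F k K Vk := by
  have hY := norm_recordPhi_recordDt_lt hk Vk hε hε50 hVk hb hHop hq hρ hB
  have hYR : ‖B - hopLinGraphC F k K Vk (recordDt F k K Vk ρ B)‖ < 1 / (10 ^ 8 * (F.P K).d * (F.P K).L) := by linarith [norm_nonneg B]
  -- `Φ` has derivative `1 − h_ℂ ∘L DD̃(B)` at `B`
  have hD := hasFDerivAt_recordDt hk Vk hε hε50 hVk hb hHop hq hρ hB
  have hΦ : HasFDerivAt (fun B => B - hopLinGraphC F k K Vk (recordDt F k K Vk ρ B))
      ((1 : (FluctIdx F k K → ℂ) →L[ℂ] (FluctIdx F k K → ℂ)) -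
        (LinearMap.toContinuousLinearMap (hopLinGraphC F k K Vk)).comp (fderiv ℂ (recordDt F k K Vk ρ) B)) B :=
    (hasFDerivAt_id B).sub ((LinearMap.toContinuousLinearMap (hopLinGraphC F k K Vk)).hasFDerivAt.comp B hD.differentiableAt.hasFDerivAt)
  -- `Q̃_ℂ` is differentiable at `Φ B`
  have hQ : HasFDerivAt (recordQtC F k K Vk) (fderiv ℂ (recordQtC F k K Vk) (B - hopLinGraphC F k K Vk (recordDt F k K Vk ρ B)))
      (B - hopLinGraphC F k K Vk (recordDt F k K Vk ρ B)) :=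
    ((differentiableOn_recordQtC_ball F k K hk Vk hε hε50 hVk).differentiableAt (isOpen_ball.mem_nhds (mem_ball_zero_iff.2 hYR))).hasFDerivAt
  have hcomp := hQ.comp B hΦ
  -- the composite IS `LQ̃_ℂ` near `B`
  have hL : HasFDerivAt (fun B => recordQtC F k K Vk (B - hopLinGraphC F k K Vk (recordDt F k K Vk ρ B))) (recordLQtC F k K Vk) B := by
    refine (recordLQtC F k K Vk).hasFDerivAt.congr_of_eventuallyEq ?_
    filter_upwards [isOpen_ball.mem_nhds (mem_ball_zero_iff.2 hB)] with y hy
    exact recordQtC_sub_hop_recordDt_eq F k K hk Vk hε hε50 hVk hA hb hHop hq hρ (mem_ball_zero_iff.1 hy)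
  exact hcomp.unique hL

include hk hε hε50 hVk hb hHop hq hρ in
/-- ★★ **`DQ̃_ℂ(B′) = LQ̃_ℂ ∘L DΨ(B′)` at `B′ = Φ B`**, `‖B‖ < ρ`, under `RecordB0BlockInvertible` (right-multiply §2's identity by `DΨ(Φ B)`, `DΦ·DΨ = 1`): the derivative of the constraint along
the fibre chart factors through its linearisation — print's «coefficient at the variable B′(b₀(c))» device. [cite: Balaban1987RG1, p.267] -/
theorem fderiv_recordQtC_recordPhi_eq (hA : RecordB0BlockInvertible F k K Vk) {B : FluctIdx F k K → ℂ} (hB : ‖B‖ < ρ) :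
    fderiv ℂ (recordQtC F k K Vk) (B - hopLinGraphC F k K Vk (recordDt F k K Vk ρ B)) =
      (recordLQtC F k K Vk).comp
        ((1 : (FluctIdx F k K → ℂ) →L[ℂ] (FluctIdx F k K → ℂ)) +
          (LinearMap.toContinuousLinearMap (hopLinGraphC F k K Vk)).comp
            (fderiv ℂ (recordCtC F k K Vk) (B - hopLinGraphC F k K Vk (recordDt F k K Vk ρ B)))) := by
  have h := fderiv_recordQtC_recordPhi_comp_fderiv_recordPhi hk Vk hε hε50 hVk hb hHop hq hρ hA hB
  have hprod := (fderiv_recordPsi_mul_one_sub_hop_comp_fderiv_recordDt hk Vk hε hε50 hVk hb hHop hq hρ hB).2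
  -- `DQ̃ = DQ̃ ∘ (DΦ ∘ DΨ) = (DQ̃ ∘ DΦ) ∘ DΨ = LQ̃ ∘ DΨ`
  have h1 : ((1 : (FluctIdx F k K → ℂ) →L[ℂ] (FluctIdx F k K → ℂ)) -
        (LinearMap.toContinuousLinearMap (hopLinGraphC F k K Vk)).comp (fderiv ℂ (recordDt F k K Vk ρ) B)).comp
      ((1 : (FluctIdx F k K → ℂ) →L[ℂ] (FluctIdx F k K → ℂ)) +
        (LinearMap.toContinuousLinearMap (hopLinGraphC F k K Vk)).comp
          (fderiv ℂ (recordCtC F k K Vk) (B - hopLinGraphC F k K Vk (recordDt F k K Vk ρ B)))) = 1 := hprod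
  rw [← h, ContinuousLinearMap.comp_assoc, h1, ContinuousLinearMap.one_def, ContinuousLinearMap.comp_id]

end Letters

end Summit.QuantumFields.YangMills.Theorems.BalabanUVNodesPortS1

end
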